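import Mathlib
import HarnessLib
import Summits.AtomisticToContinuum.FouriersLaw.Theses.ThermostatLiouville
import Summits.AtomisticToContinuum.FouriersLaw.Theorems.BondHeatUncertaintySubdiffusiveBondHeatBathBondReductionGenerator

/-!
# Birth skeleton (BC3) for crux `ThermostatLiouville.FirstOrderRigidity`
(item `stmt-AtomisticToContinuum-13699`, rank-2 crux of route
`route-AtomisticToContinuum-ThermostatLiouville`; sub-problem `FouriersLaw`;
registrar `planner-skel-stmt-AtomisticToContinuum-13699-0`, 2026-08-17)

Crux (FIXED, concluded BY NAME below).  Half-line pinned anharmonic chain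
(`U = ω₂q²/2 + lam q⁴/4`, `V = r²/2 + β r⁴/4`, all parameters `> 0`), ONE Langevin bath `(T, γ)` at
site `0`.  Every first-order functional `r : (n : ℕ) → (PhaseSpace n → ℝ) → ℝ` that is (H1) linear on
temperate cylinder observables, (H2) consistent, (H3) normalised, (H4) tempered uniformly in the
position of the window and (H5) stationary to first order (`r (n+1) (L_T (g ∘ castSucc)) = 0`)
vanishes: `r n g = 0`.

## Line `birth` — NO RADIATION × ZERO-FLUX RIGIDITY, glued by the exact energy balance at the bath

Write `J(r) := r 2 (j₀)` for the first-order mean energy current through the bath bond `(0,1)`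
(`j₀ = OscillatorChain.bondCurrent 2 0 = -½(p₀+p₁)V'(q₁-q₀)`, BLR eq. (23)) and
`θ(r) := r 1 (p₀²)` for the first-order kinetic temperature of the thermostatted site.

* `stub_noFlux` (NO FIRST-ORDER RADIATION; the transport half): under (H1)–(H5), `J(r) = 0`.
  By the first-order continuity equation `r(j_k) = J(r)` for every bond `k` (stationarity on the site
  energies), so `J ≠ 0` is a steady energy current through the WHOLE half-line carried by a
  perturbation whose local first-order observables are bounded uniformly in position (H4): a conductor
  of infinite length passing a current under bounded driving, i.e. zero resistivity — a ballistic
  channel.  Positive bulk resistivity of the anharmonic pinned chain in linear response (the phonon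
  Boltzmann picture: AokiLukkarinenSpohn2006 §3, LefevereSchenkel2006; BonettoLebowitzReyBellet2000)
  is exactly `J = 0`.  FALSE at the harmonic corner `lam = β = 0` (RiederLebowitzLieb1967: flat
  profile with flux; KomorowskiEtAl2020: absorption probability `𝔤(k) < 1`, so thermal radiation
  from infinity at `T' ≠ T` is a tempered homogeneous functional with `J ≠ 0` — the witness of the
  route's support item `HarmonicCalibration`).  Size XL (the anti-ballistic core of the crux).
* `stub_zeroFluxRigidity` (EQUILIBRIUM RIGIDITY AT ZERO FLUX; the ergodic half): under (H1)–(H5)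
  AND `θ(r) = 0` (no first-order heat is exchanged with the bath: the bath term of `L_T` applied to
  the site-0 energy is `γ(T - p₀²)`, whose `r`-value is `-γ θ(r)` by (H3)), `r = 0`.  Mechanism: for
  an `L²`-regular functional `r = ⟨h, ·⟩_{μ_T}` the first-order entropy production
  `γT‖∂_{p₀}h‖²` equals the entropy flux at infinity, which vanishes with the energy flux; then
  `∂_{p₀}h = 0`, the Eckmann–Pillet–Rey-Bellet controllability induction along the chain
  (`V'' = 1 + 3βr² ≥ 1` couples `q_k` to `p_{k+1}`; EckmannPilletReyBellet1999a §3, in tree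
  `LangevinChainHormander`) makes `h` tail-measurable, and the tail of the one-dimensional Gibbs
  state is trivial (GeorgiiGibbsMeasures2011 Ch. 8), so `h` is constant and `r = r(1)·const = 0`
  by (H3); the singular (non-`L²`) zero-flux part is where (H4)'s uniformity in position is spent.
  FALSE at the harmonic corner for a DIFFERENT reason than `stub_noFlux`: superpose incoming
  radiation hotter than `T` in one phonon band and colder in another so that the net absorbed power
  vanishes — `θ = 0`, `J = 0`, `r ≠ 0` (normal modes never mix; KomorowskiEtAl2020's
  frequency-resolved absorption `𝔤(k)`).  So this stub encodes MODE MIXING of the linearised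
  anharmonic dynamics, `stub_noFlux` encodes FINITE CONDUCTIVITY.  Size L–XL.
* COMPOSITION `FirstOrderRigidity_of` (sorry-free, kernel-checked): the EXACT FIRST-ORDER ENERGY
  BALANCE AT THE THERMOSTAT `J(r) = -γ θ(r)`, derived inside this file from (H5) applied to the
  bath-site energy `e₀ = p₀²/2 + U(q₀) + ½V(q₁-q₀)` on the 2-site window (so `L_T` acts on the
  3-site window), the landed generator identity `L_{T,T} e₀ = -j₀ + γ(T - p₀²)`
  (`Theorems.SubdiffusiveBondHeat.generator_siteEnergy`, BLR §5.2 (23)–(25)), linearity (H1) on the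
  temperate pieces, normalisation (H3) and two consistency descents (H2) (`3 ↦ 2` sites for `j₀`,
  `3 ↦ 2 ↦ 1` for `p₀²`), and `γ > 0`.  Hence `stub_noFlux` gives `θ(r) = 0` and
  `stub_zeroFluxRigidity` gives `r = 0`.

Hardest stub: `stub_noFlux` (no printed statement controls the first-order current of the
thermostatted ANHARMONIC half-line; the nearest results are the harmonic scattering theory
KomorowskiEtAl2020/KomorowskiOlla2020, where it is false, and finite-`N` NESS theory
EckmannPilletReyBellet1999a/Carmona2007, which is `N`-dependent).
Why the cut is not a costume: `stub_noFlux` concludes ONE scalar identity and says nothing about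
`r` away from the bath bond; `stub_zeroFluxRigidity` needs exactly that scalar as an input and is
false without it even for the anharmonic chain's harmonic corner with zero net flux; the two fail at
`lam = β = 0` for independent reasons (flux-carrying vs. flux-free non-thermal radiation), so neither
is the crux reworded, and the seam is a genuine identity (the bath balance), not `exact ⟨h₁, h₂⟩`.
Refuter structure honoured (item evidence ATTACK.md §7b, 2026-08-15: "every finite truncation of
H1–H5 has nonzero models … all rigidity sits in H4's uniformity in position"): both stubs keep (H4)
verbatim and are global statements; no finite-level unique-continuation stub is filed.
Disproof used: none on file (`ledger crux ls stmt-AtomisticToContinuum-13699`: no `Disproof.lean`,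
no `Negative/` lemma, no dead lines, 2026-08-17).
BC3 probes (planner folder `bc/`, quoted in `Lines/birth.md`): `stub → FirstOrderRigidity` and
`stub → FouriersLaw` by `first | exact? | simpa | aesop` FAIL for both stubs.
-/

noncomputable section

open Literature.MathematicalPhysics.KineticTheory.HeatConduction

namespace Summit.AtomisticToContinuum.FouriersLaw.Cruxes.FirstOrderRigidity

namespace Birth

/-! ## The two registered stubs -/

/-- **stub 1 — `stub_noFlux` (no first-order radiation through the thermostatted half-line).**
For `pinnedChain ω₂ lam β γ` (all `> 0`), `T > 0` and every first-order functional `r` satisfying the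
five hypotheses (H1)–(H5) of `FirstOrderRigidity` verbatim, the first-order mean energy current
through the bath bond vanishes: `r 2 (bondCurrent 2 0) = 0`.  Transport half of the crux (positive
resistivity of the infinite anharmonic half-line in linear response); false at `lam = β = 0`. -/
theorem stub_noFlux :
    ∀ ω₂ lam β γ : ℝ, 0 < ω₂ → 0 < lam → 0 < β → 0 < γ → ∀ T : ℝ, 0 < T → ∀ r : (n : ℕ) → (Literature.MathematicalPhysics.KineticTheory.HeatConduction.PhaseSpace n → ℝ) → ℝ, (∀ (n : ℕ) (a b : ℝ) (g h : Literature.MathematicalPhysics.KineticTheory.HeatConduction.PhaseSpace n → ℝ), g.HasTemperateGrowth → h.HasTemperateGrowth → r n (fun z => a * g z + b * h z) = a * r n g + b * r n h) → (∀ (n : ℕ) (g : Literature.MathematicalPhysics.KineticTheory.HeatConduction.PhaseSpace n → ℝ), g.HasTemperateGrowth → r (n + 1) (fun y => g (fun i => y.1 (Fin.castSucc i), fun i => y.2 (Fin.castSucc i))) = r n g) → (∀ n : ℕ, r n (fun _ => 1) = 0) → (∀ n m : ℕ, ∃ C : ℝ, ∀ (a : ℕ) (g : Literature.MathematicalPhysics.KineticTheory.HeatConduction.PhaseSpace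 n → ℝ), g.HasTemperateGrowth → (∀ z, |g z| ≤ (1 + ‖z‖) ^ m) → |r (a + n) (fun y => g (fun i => y.1 (Fin.natAdd a i), fun i => y.2 (Fin.natAdd a i)))| ≤ C) → (∀ (n : ℕ) (g : Literature.MathematicalPhysics.KineticTheory.HeatConduction.PhaseSpace n → ℝ), g.HasTemperateGrowth → r (n + 1) (fun y => (Literature.MathematicalPhysics.KineticTheory.HeatConduction.pinnedChain ω₂ lam β γ).generator (n + 1) T T (fun y' => g (fun i => y'.1 (Fin.castSucc i), fun i => y'.2 (Fin.castSucc i))) y) = 0) → r 2 (fun z => (Literature.MathematicalPhysics.KineticTheory.HeatConduction.pinnedChain ω₂ lam β γ).bondCurrent 2 0 z) = 0 := by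
  sorry

/-- **stub 2 — `stub_zeroFluxRigidity` (equilibrium rigidity of the thermostatted half-line at zero
flux).**  For `pinnedChain ω₂ lam β γ` (all `> 0`), `T > 0` and every first-order functional `r`
satisfying (H1)–(H5) of `FirstOrderRigidity` verbatim AND exchanging no first-order heat with the bath,
`r 1 (p₀²) = 0`, the functional vanishes on every temperate cylinder observable.  Ergodic half of the
crux (entropy production = entropy flux at infinity = 0, then Hörmander/EPR controllability along the
chain and tail triviality of the 1-D Gibbs state); false at `lam = β = 0` by flux-free non-thermal
radiation. -/
theorem stub_zeroFluxRigidity :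
    ∀ ω₂ lam β γ : ℝ, 0 < ω₂ → 0 < lam → 0 < β → 0 < γ → ∀ T : ℝ, 0 < T → ∀ r : (n : ℕ) → (Literature.MathematicalPhysics.KineticTheory.HeatConduction.PhaseSpace n → ℝ) → ℝ, (∀ (n : ℕ) (a b : ℝ) (g h : Literature.MathematicalPhysics.KineticTheory.HeatConduction.PhaseSpace n → ℝ), g.HasTemperateGrowth → h.HasTemperateGrowth → r n (fun z => a * g z + b * h z) = a * r n g + b * r n h) → (∀ (n : ℕ) (g : Literature.MathematicalPhysics.KineticTheory.HeatConduction.PhaseSpace n → ℝ), g.HasTemperateGrowth → r (n + 1) (fun y => g (fun i => y.1 (Fin.castSucc i), fun i => y.2 (Fin.castSucc i))) = r n g) → (∀ n : ℕ, r n (fun _ => 1) = 0) → (∀ n m : ℕ, ∃ C : ℝ, ∀ (a : ℕ) (g : Literature.MathematicalPhysics.KineticTheory.HeatConduction.PhaseSpace n → ℝ), g.HasTemperateGrowth → (∀ z, |g z| ≤ (1 + ‖z‖) ^ m) → |r (a + n) (fun y => g (fun i => y.1 (Fin.natAdd a i), fun i => y.2 (Fin.natAdd a i)))| ≤ C) →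 (∀ (n : ℕ) (g : Literature.MathematicalPhysics.KineticTheory.HeatConduction.PhaseSpace n → ℝ), g.HasTemperateGrowth → r (n + 1) (fun y => (Literature.MathematicalPhysics.KineticTheory.HeatConduction.pinnedChain ω₂ lam β γ).generator (n + 1) T T (fun y' => g (fun i => y'.1 (Fin.castSucc i), fun i => y'.2 (Fin.castSucc i))) y) = 0) → r 1 (fun z => (z.2 0) ^ 2) = 0 → ∀ (n : ℕ) (g : Literature.MathematicalPhysics.KineticTheory.HeatConduction.PhaseSpace n → ℝ), g.HasTemperateGrowth → r n g = 0 := by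
  sorry

/-! ## Temperate growth of the polynomial observables used by the seam (all sorry-free) -/

/-- Coordinate positions are of temperate growth (continuous linear maps). [folklore] -/
@[fun_prop]
theorem hasTemperateGrowth_coordQ {n : ℕ} (i : Fin n) :
    Function.HasTemperateGrowth (fun z : PhaseSpace n => z.1 i) :=
  ((ContinuousLinearMap.proj (R := ℝ) i).comp
    (ContinuousLinearMap.fst ℝ (Fin n → ℝ) (Fin n → ℝ))).hasTemperateGrowth

/-- Coordinate momenta are of temperate growth (continuous linear maps). [folklore] -/
@[fun_prop]
theorem hasTemperateGrowth_coordP {n : ℕ} (i : Fin n) :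
    Function.HasTemperateGrowth (fun z : PhaseSpace n => z.2 i) :=
  ((ContinuousLinearMap.proj (R := ℝ) i).comp
    (ContinuousLinearMap.snd ℝ (Fin n → ℝ) (Fin n → ℝ))).hasTemperateGrowth

/-- Division by a constant preserves temperate growth. [folklore] -/
@[fun_prop]
theorem hasTemperateGrowth_div_const {E : Type*} [NormedAddCommGroup E] [NormedSpace ℝ E]
    {f : E → ℝ} (hf : f.HasTemperateGrowth) (c : ℝ) :
    Function.HasTemperateGrowth (fun x => f x / c) := by
  have h : (fun x => f x / c) = fun x => f x * c⁻¹ := by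
    funext x; ring
  rw [h]
  exact hf.mul (Function.HasTemperateGrowth.const _)

/-- Closed form of the bath-bond current of `pinnedChain`: `j₀ = -½(p₀+p₁)((q₁-q₀) + β(q₁-q₀)³)`, on any
window with at least two sites (`i0 = 0`, `i1 = 1`). [Bonetto–Lebowitz–Rey-Bellet 2000, eq. (23)] -/
theorem bondCurrent_bathBond (ω₂ lam β γ : ℝ) {N : ℕ} {i0 i1 : Fin N} (hi : i1.val = i0.val + 1)
    (z : PhaseSpace N) :
    (pinnedChain ω₂ lam β γ).bondCurrent N i0 z =
      -((z.2 i0 + z.2 i1) / 2 * ((z.1 i1 - z.1 i0) + β * (z.1 i1 - z.1 i0) ^ 3)) := by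
  rw [Summit.AtomisticToContinuum.FouriersLaw.Theorems.SubdiffusiveBondHeat.bondCurrent_siteZero
    (pinnedChain ω₂ lam β γ) hi z, pinnedChain_deriv_V]

/-- The bath-bond current on the 2-site window, as a function. -/
theorem bondCurrent_two_eq (ω₂ lam β γ : ℝ) :
    (fun z : PhaseSpace 2 => (pinnedChain ω₂ lam β γ).bondCurrent 2 0 z) =
      fun z => -((z.2 0 + z.2 1) / 2 * ((z.1 1 - z.1 0) + β * (z.1 1 - z.1 0) ^ 3)) :=
  funext fun z => bondCurrent_bathBond ω₂ lam β γ (i0 := 0) (i1 := 1) rfl z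

/-- The bath-bond current on the 3-site window, as a function. -/
theorem bondCurrent_three_eq (ω₂ lam β γ : ℝ) :
    (fun z : PhaseSpace 3 => (pinnedChain ω₂ lam β γ).bondCurrent 3 0 z) =
      fun z => -((z.2 0 + z.2 1) / 2 * ((z.1 1 - z.1 0) + β * (z.1 1 - z.1 0) ^ 3)) :=
  funext fun z => bondCurrent_bathBond ω₂ lam β γ (i0 := 0) (i1 := 1) rfl z

theorem hasTemperateGrowth_bondCurrent_two (ω₂ lam β γ : ℝ) :
    Function.HasTemperateGrowth (fun z : PhaseSpace 2 => (pinnedChain ω₂ lam β γ).bondCurrent 2 0 z) := by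
  rw [bondCurrent_two_eq]
  fun_prop

theorem hasTemperateGrowth_bondCurrent_three (ω₂ lam β γ : ℝ) :
    Function.HasTemperateGrowth (fun z : PhaseSpace 3 => (pinnedChain ω₂ lam β γ).bondCurrent 3 0 z) := by
  rw [bondCurrent_three_eq]
  fun_prop

/-- The bath-site energy `e₀ = p₀²/2 + U(q₀) + ½V(q₁-q₀)` on the 2-site window is temperate. -/
theorem hasTemperateGrowth_siteEnergy_two (ω₂ lam β γ : ℝ) :
    Function.HasTemperateGrowth (fun z : PhaseSpace 2 =>
      (z.2 0) ^ 2 / 2 + (pinnedChain ω₂ lam β γ).U (z.1 0) + (pinnedChain ω₂ lam β γ).V (z.1 1 - z.1 0) / 2) := by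
  show Function.HasTemperateGrowth (fun z : PhaseSpace 2 =>
      (z.2 0) ^ 2 / 2 + (ω₂ * (z.1 0) ^ 2 / 2 + lam * (z.1 0) ^ 4 / 4) +
        ((z.1 1 - z.1 0) ^ 2 / 2 + β * (z.1 1 - z.1 0) ^ 4 / 4) / 2)
  fun_prop

/-! ## The seam: the exact first-order energy balance at the thermostat -/

/-- **First-order energy balance at the bath** (sorry-free).  For every first-order functional `r`
satisfying (H1) linearity, (H2) consistency, (H3) normalisation and (H5) first-order stationarity for
`pinnedChain ω₂ lam β γ` with the bath at `T`:  `r 2 (j₀) = -γ · r 1 (p₀²)` — the first-order energy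
current through the bath bond equals the first-order heat delivered by the bath.  Proof: (H5) on the
2-site observable `e₀ = p₀²/2 + U(q₀) + ½V(q₁-q₀)` and the generator identity
`L_{T,T} e₀ = -j₀ + γ(T - p₀²)` on three sites, then (H1), (H3), (H2).
[Bonetto–Lebowitz–Rey-Bellet 2000, §5.2 (23)–(25); Kundu–Dhar–Narayan 2009 (bath heat identity)] -/
theorem bathBalance (ω₂ lam β γ T : ℝ)
    (r : (n : ℕ) → (PhaseSpace n → ℝ) → ℝ)
    (hlin : ∀ (n : ℕ) (a b : ℝ) (g h : PhaseSpace n → ℝ), g.HasTemperateGrowth → h.HasTemperateGrowth →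
      r n (fun z => a * g z + b * h z) = a * r n g + b * r n h)
    (hcons : ∀ (n : ℕ) (g : PhaseSpace n → ℝ), g.HasTemperateGrowth →
      r (n + 1) (fun y => g (fun i => y.1 (Fin.castSucc i), fun i => y.2 (Fin.castSucc i))) = r n g)
    (hnorm : ∀ n : ℕ, r n (fun _ => 1) = 0)
    (hstat : ∀ (n : ℕ) (g : PhaseSpace n → ℝ), g.HasTemperateGrowth →
      r (n + 1) (fun y => (pinnedChain ω₂ lam β γ).generator (n + 1) T T
        (fun y' => g (fun i => y'.1 (Fin.castSucc i), fun i => y'.2 (Fin.castSucc i))) y) = 0) :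
    r 2 (fun z => (pinnedChain ω₂ lam β γ).bondCurrent 2 0 z) = -γ * r 1 (fun z => (z.2 0) ^ 2) := by
  -- regularity of the potentials
  have hU : Differentiable ℝ (pinnedChain ω₂ lam β γ).U :=
    (pinnedChain_contDiff_U ω₂ lam β γ (n := 1)).differentiable one_ne_zero
  have hV : Differentiable ℝ (pinnedChain ω₂ lam β γ).V :=
    (pinnedChain_contDiff_V ω₂ lam β γ (n := 1)).differentiable one_ne_zero
  -- (H5) on the bath-site energy of the 2-site window
  have h5 := hstat 2 (fun z : PhaseSpace 2 =>
      (z.2 0) ^ 2 / 2 + (pinnedChain ω₂ lam β γ).U (z.1 0) + (pinnedChain ω₂ lam β γ).V (z.1 1 - z.1 0) / 2)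
    (hasTemperateGrowth_siteEnergy_two ω₂ lam β γ)
  -- the generator identity `L e₀ = -j₀ + γ (T - p₀²)` on the 3-site window, in linear-combination form
  have hgen : (fun y : PhaseSpace 3 => (pinnedChain ω₂ lam β γ).generator 3 T T
      (fun y' : PhaseSpace 3 => (fun z : PhaseSpace 2 =>
        (z.2 0) ^ 2 / 2 + (pinnedChain ω₂ lam β γ).U (z.1 0) + (pinnedChain ω₂ lam β γ).V (z.1 1 - z.1 0) / 2)
          (fun i => y'.1 (Fin.castSucc i), fun i => y'.2 (Fin.castSucc i))) y) =
      fun y => (-1) * (pinnedChain ω₂ lam β γ).bondCurrent 3 0 y + γ * (T * 1 + (-1) * (y.2 0) ^ 2) := by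
    funext y
    have hw : (fun y' : PhaseSpace 3 => (fun z : PhaseSpace 2 =>
        (z.2 0) ^ 2 / 2 + (pinnedChain ω₂ lam β γ).U (z.1 0) + (pinnedChain ω₂ lam β γ).V (z.1 1 - z.1 0) / 2)
          (fun i => y'.1 (Fin.castSucc i), fun i => y'.2 (Fin.castSucc i))) =
        fun z : PhaseSpace 3 =>
          (z.2 0) ^ 2 / 2 + (pinnedChain ω₂ lam β γ).U (z.1 0) + (pinnedChain ω₂ lam β γ).V (z.1 1 - z.1 0) / 2 := by
      funext y'
      simp only [Fin.castSucc_zero, Fin.castSucc_one]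
    rw [hw, Summit.AtomisticToContinuum.FouriersLaw.Theorems.SubdiffusiveBondHeat.generator_siteEnergy
      (pinnedChain ω₂ lam β γ) hU hV (i0 := 0) (i1 := 1) rfl rfl T T y]
    show -(pinnedChain ω₂ lam β γ).bondCurrent 3 0 y + γ * (T - (y.2 0) ^ 2) = _
    ring
  rw [hgen] at h5
  -- linearity on the three temperate pieces
  have hj3 := hasTemperateGrowth_bondCurrent_three ω₂ lam β γ
  have hp3 : Function.HasTemperateGrowth (fun z : PhaseSpace 3 => (z.2 0) ^ 2) := by fun_prop
  have hq3 : Function.HasTemperateGrowth (fun z : PhaseSpace 3 => T * 1 + (-1) * (z.2 0) ^ 2) := by fun_prop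
  have hl1 := hlin 3 (-1) γ (fun z => (pinnedChain ω₂ lam β γ).bondCurrent 3 0 z)
    (fun z => T * 1 + (-1) * (z.2 0) ^ 2) hj3 hq3
  have hl2 := hlin 3 T (-1) (fun _ => (1 : ℝ)) (fun z => (z.2 0) ^ 2)
    (Function.HasTemperateGrowth.const _) hp3
  beta_reduce at hl1 hl2
  rw [hl1, hl2, hnorm 3] at h5
  -- consistency: descend `j₀` from 3 to 2 sites and `p₀²` from 3 to 1 site
  have hcj := hcons 2 (fun z => (pinnedChain ω₂ lam β γ).bondCurrent 2 0 z)
    (hasTemperateGrowth_bondCurrent_two ω₂ lam β γ)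
  have hwj : (fun y : PhaseSpace 3 => (fun z : PhaseSpace 2 => (pinnedChain ω₂ lam β γ).bondCurrent 2 0 z)
      (fun i => y.1 (Fin.castSucc i), fun i => y.2 (Fin.castSucc i))) =
      fun y => (pinnedChain ω₂ lam β γ).bondCurrent 3 0 y := by
    funext y
    beta_reduce
    rw [bondCurrent_bathBond ω₂ lam β γ (i0 := (0 : Fin 2)) (i1 := 1) rfl,
      bondCurrent_bathBond ω₂ lam β γ (i0 := (0 : Fin 3)) (i1 := 1) rfl]
    simp only [Fin.castSucc_zero, Fin.castSucc_one]
  rw [hwj] at hcj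
  have hp1 : Function.HasTemperateGrowth (fun z : PhaseSpace 1 => (z.2 0) ^ 2) := by fun_prop
  have hp2 : Function.HasTemperateGrowth (fun z : PhaseSpace 2 => (z.2 0) ^ 2) := by fun_prop
  have hc1 := hcons 1 (fun z : PhaseSpace 1 => (z.2 0) ^ 2) hp1
  have hc2 := hcons 2 (fun z : PhaseSpace 2 => (z.2 0) ^ 2) hp2
  simp only [Fin.castSucc_zero] at hc1 hc2
  -- assemble
  rw [hcj, hc2, hc1] at h5
  linarith

/-! ## The composition -/

/-- **Skeleton theorem — the crux `ThermostatLiouville.FirstOrderRigidity` BY NAME from the two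
registered stub STATEMENTS** (sorry-free; axioms `propext`, `Classical.choice`, `Quot.sound`):
`stub_noFlux`-statement → `stub_zeroFluxRigidity`-statement → `FirstOrderRigidity`.
Seam: `bathBalance` turns `J(r) = 0` into `r 1 (p₀²) = 0` (`γ > 0`), which is the extra input of the
second stub. -/
theorem FirstOrderRigidity_of :
    (∀ ω₂ lam β γ : ℝ, 0 < ω₂ → 0 < lam → 0 < β → 0 < γ → ∀ T : ℝ, 0 < T → ∀ r : (n : ℕ) → (Literature.MathematicalPhysics.KineticTheory.HeatConduction.PhaseSpace n → ℝ) → ℝ, (∀ (n : ℕ) (a b : ℝ) (g h : Literature.MathematicalPhysics.KineticTheory.HeatConduction.PhaseSpace n → ℝ), g.HasTemperateGrowth → h.HasTemperateGrowth → r n (fun z => a * g z + b * h z) = a * r n g + b * r n h) → (∀ (n : ℕ) (g : Literature.MathematicalPhysics.KineticTheory.HeatConduction.PhaseSpace n → ℝ), g.HasTemperateGrowth → r (n + 1) (fun y => g (fun i => y.1 (Fin.castSucc i), fun i => y.2 (Fin.castSucc i))) = r n g) → (∀ n : ℕ, r n (fun _ => 1) = 0) → (∀ n m : ℕ, ∃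 C : ℝ, ∀ (a : ℕ) (g : Literature.MathematicalPhysics.KineticTheory.HeatConduction.PhaseSpace n → ℝ), g.HasTemperateGrowth → (∀ z, |g z| ≤ (1 + ‖z‖) ^ m) → |r (a + n) (fun y => g (fun i => y.1 (Fin.natAdd a i), fun i => y.2 (Fin.natAdd a i)))| ≤ C) → (∀ (n : ℕ) (g : Literature.MathematicalPhysics.KineticTheory.HeatConduction.PhaseSpace n → ℝ), g.HasTemperateGrowth → r (n + 1) (fun y => (Literature.MathematicalPhysics.KineticTheory.HeatConduction.pinnedChain ω₂ lam β γ).generator (n + 1) T T (fun y' => g (fun i => y'.1 (Fin.castSucc i), fun i => y'.2 (Fin.castSucc i))) y) = 0) → r 2 (fun z => (Literature.MathematicalPhysics.KineticTheory.HeatConduction.pinnedChain ω₂ lam β γ).bondCurrent 2 0 z) = 0) →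
    (∀ ω₂ lam β γ : ℝ, 0 < ω₂ → 0 < lam → 0 < β → 0 < γ → ∀ T : ℝ, 0 < T → ∀ r : (n : ℕ) → (Literature.MathematicalPhysics.KineticTheory.HeatConduction.PhaseSpace n → ℝ) → ℝ, (∀ (n : ℕ) (a b : ℝ) (g h : Literature.MathematicalPhysics.KineticTheory.HeatConduction.PhaseSpace n → ℝ), g.HasTemperateGrowth → h.HasTemperateGrowth → r n (fun z => a * g z + b * h z) = a * r n g + b * r n h) → (∀ (n : ℕ) (g : Literature.MathematicalPhysics.KineticTheory.HeatConduction.PhaseSpace n → ℝ), g.HasTemperateGrowth → r (n + 1) (fun y => g (fun i => y.1 (Fin.castSucc i), fun i => y.2 (Fin.castSucc i))) = r n g) → (∀ n : ℕ, r n (fun _ => 1) = 0) → (∀ n m : ℕ, ∃ C : ℝ, ∀ (a : ℕ) (g : Literature.MathematicalPhysics.KineticTheory.HeatConduction.PhaseSpace n → ℝ), g.HasTemperateGrowth → (∀ z, |g z| ≤ (1 + ‖z‖) ^ m) → |r (a + n) (fun y => g (fun i => y.1 (Fin.natAdd a i), fun i => y.2 (Fin.natAdd a i)))| ≤ C) →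 (∀ (n : ℕ) (g : Literature.MathematicalPhysics.KineticTheory.HeatConduction.PhaseSpace n → ℝ), g.HasTemperateGrowth → r (n + 1) (fun y => (Literature.MathematicalPhysics.KineticTheory.HeatConduction.pinnedChain ω₂ lam β γ).generator (n + 1) T T (fun y' => g (fun i => y'.1 (Fin.castSucc i), fun i => y'.2 (Fin.castSucc i))) y) = 0) → r 1 (fun z => (z.2 0) ^ 2) = 0 → ∀ (n : ℕ) (g : Literature.MathematicalPhysics.KineticTheory.HeatConduction.PhaseSpace n → ℝ), g.HasTemperateGrowth → r n g = 0) →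
    _root_.Summit.AtomisticToContinuum.FouriersLaw.Theses.ThermostatLiouville.FirstOrderRigidity := by
  intro hNF hZR ω₂ lam β γ hω hl hβ hγ T hT r hlin hcons hnorm htemp hstat
  -- no radiation through the bath bond
  have hJ : r 2 (fun z => (pinnedChain ω₂ lam β γ).bondCurrent 2 0 z) = 0 :=
    hNF ω₂ lam β γ hω hl hβ hγ T hT r hlin hcons hnorm htemp hstat
  -- the exact balance turns it into `r 1 (p₀²) = 0`
  have hbal := bathBalance ω₂ lam β γ T r hlin hcons hnorm hstat
  have hθ : r 1 (fun z : PhaseSpace 1 => (z.2 0) ^ 2) = 0 := by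
    have h : γ * r 1 (fun z : PhaseSpace 1 => (z.2 0) ^ 2) = 0 := by linarith
    rcases mul_eq_zero.mp h with h | h
    · exact absurd h hγ.ne'
    · exact h
  -- zero-flux rigidity
  exact hZR ω₂ lam β γ hω hl hβ hγ T hT r hlin hcons hnorm htemp hstat hθ

/-- The crux from the two stubs themselves (this theorem inherits their `sorry`s and contains none):
certifies that `stub_noFlux` and `stub_zeroFluxRigidity` have exactly the hypothesis types of
`FirstOrderRigidity_of`. -/
theorem FirstOrderRigidity_of_stubs :
    _root_.Summit.AtomisticToContinuum.FouriersLaw.Theses.ThermostatLiouville.FirstOrderRigidity :=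
  FirstOrderRigidity_of stub_noFlux stub_zeroFluxRigidity

end Birth

end Summit.AtomisticToContinuum.FouriersLaw.Cruxes.FirstOrderRigidity

end
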